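import Summits.ABC.StewartYu.PadicTwistMain
import Summits.ABC.StewartYu.PadicTwistPMKStep
import Summits.ABC.StewartYu.DescentStepQ
import HarnessLib

/-!
# Cell abc-stewartyu, WP-Y provider B (vi): the ± class invariant `InvPM` and the descent chain `main_pm`

`Summits/ABC/StewartYu/PadicTwistPMMain.lean` — seat p3 (crux `W80OneModFour` stmt-ABC-19487; memo-05 §2).
ADD-ON on p2's re-landed `PadicTwistMain.lean` (reuses its `KSizes`/`KFinal`): the ± invariant
`InvPM.cls := ∃ ρ sgn, ρ^G = 1 ∧ sgn = ±1 ∧ cls u = sgn u·ρ on the support`, the inner chain `kchain_pm`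
(p2's `kchain` on `padic_kstep_pm`), the Props `HalfStepPM`/`SiegelPM`/`EndgamePM`, and `main_pm`.
Kernel-checked against p2's re-landed `PadicTwistMain` (reusing its `KSizes`/`KFinal`). [folklore].
-/

noncomputable section

open NormedSpace Finset IsUltrametricDist
open Literature.NumberTheory.Transcendental
open Literature.NumberTheory.Transcendental.PadicCW77 (condExp)
open Literature.NumberTheory.Transcendental.CW77.Setup (Idx Tau tauNorm)
open scoped Nat

namespace Summit.ABC.StewartYu
/-! ## (from p2's PadicTwistMain.lean, ± class invariant) -/


open Literature.NumberTheory.Transcendental.CW77.Setup (Idx Tau tauNorm)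

namespace TwistSetup

variable {p : ℕ} [Fact p.Prime] (S : TwistSetup p) {h Lb : ℕ}

/-! ### The invariant with class -/

/-- **The induction invariant of the twisted descent at level `J`**: p3's sign-free invariant
`SetupQ.Inv` (integers `p(u)` supported in the box of level `J`, not all zero, bounded by `P`, with
`coreSum_{J,τ}(s) = 0` for all odd `s < 2ᴶ S₀`, `|τ| < T/2ᴶ`) AND a common class value `ρ ∈ μ_G` of
all unknowns with a non-zero coefficient. [cite: Yu1990, §2.4 (2.64)–(2.65)] -/
structure InvPM (J₀ : ℕ) (L : Fin S.d → ℕ) (Lθ S₀ T : ℕ) (P : ℤ) (J : ℕ) (pv : Idx S.d h Lb → ℤ) :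
    Prop where
  /-- the sign-free invariant -/
  inv : S.toQ.Inv J₀ L Lθ S₀ T P J pv
  /-- the class -/
  cls : ∃ ρ : ℚ_[p], ∃ sgn : Idx S.d h Lb → ℤ, ρ ^ S.G = 1 ∧
    (∀ u, pv u ≠ 0 → sgn u = 1 ∨ sgn u = -1) ∧ ∀ u, pv u ≠ 0 → S.cls u = (sgn u : ℚ_[p]) * ρ

/-! ### The inputs of the inner chain at level `J` -/

/-! ### The inner chain, proved -/

/-- **The inner chain at level `J`**: from the classed invariant at level `J`, for every `k ≤ d`,
`coreSum_{J,τ}(s) = 0` for odd `s < 2^{k+J} S₀` and `|τ| < T/2ᴶ − k t` (`S₀` even, `t ≥ 1`,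
`(d+1) t ≤ T/2ᴶ`), by `k` applications of `padic_kstep` on the class of the invariant.
[cite: Yu1990, §2.4 Lemma 2.3] [cite: Waldschmidt1980, Lemma 3.6 (p. 272)] -/
theorem kchain_pm {J₀ J : ℕ} {L : Fin S.d → ℕ} {Lθ S₀ T t : ℕ} {P : ℤ} {pv : Idx S.d h Lb → ℤ}
    (inv : S.InvPM J₀ L Lθ S₀ T P J pv) (hS₀ : Even S₀) (ht : 1 ≤ t)
    (htT : (S.d + 1) * t ≤ T / 2 ^ J) (hΛ : ‖S.Λ₀‖ ≤ (p : ℝ)⁻¹)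
    {Dmax Mmax : ℕ → ℝ} (hsz : S.KSizes J₀ J L Lθ S₀ T t pv Dmax Mmax)
    (hfin : S.KFinal (h := h) (Lb := Lb) J S₀ t Dmax Mmax) :
    ∀ k, k ≤ S.d → ∀ s, s < 2 ^ (k + J) * S₀ → Odd s → ∀ τ : Tau S.d,
      tauNorm τ < T / 2 ^ J - k * t →
      S.toQ.coreSum J₀ J (S.toQ.flat.box (h := h) (Lb := Lb) L Lθ J) pv τ s = 0 := by
  obtain ⟨ρ, sgn, hρG, hsgn, hcls⟩ := inv.cls
  have hsgn' : ∀ u ∈ S.toQ.flat.box (h := h) (Lb := Lb) L Lθ J, pv u ≠ 0 → sgn u = 1 ∨ sgn u = -1 :=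
    fun u _ hu => hsgn u hu
  have hcls' : ∀ u ∈ S.toQ.flat.box (h := h) (Lb := Lb) L Lθ J, pv u ≠ 0 →
      S.cls u = (sgn u : ℚ_[p]) * ρ := fun u _ hu => hcls u hu
  intro k
  induction k with
  | zero =>
    intro _ s hs hodd τ hτ
    rw [zero_add] at hs
    exact inv.inv.rel s hs hodd τ (by simpa using hτ)
  | succ k ih =>
    intro hk s hs hodd τ hτ
    have hk' : k < S.d := by omega
    have hzero := ih hk'.le
    obtain ⟨r, hr⟩ := hS₀
    set kpts : ℕ := 2 ^ (k + J) * S₀ / 2 with hkpts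
    have hkpts_eq : kpts = 2 ^ (k + J) * r := by
      rw [hkpts, hr, show 2 ^ (k + J) * (r + r) = 2 ^ (k + J) * r * 2 by ring, Nat.mul_div_cancel _ two_pos]
    have h2k : 2 * kpts = 2 ^ (k + J) * S₀ := by rw [hkpts_eq, hr]; ring
    have h4k : 4 * kpts = 2 ^ (k + 1 + J) * S₀ := by
      rw [hkpts_eq, hr, show k + 1 + J = (k + J) + 1 by ring, pow_succ]; ring
    have hzero' : ∀ i < kpts, ∀ τ'' : Tau S.d, tauNorm τ'' < T / 2 ^ J - k * t →
        S.toQ.coreSum J₀ J (S.toQ.flat.box (h := h) (Lb := Lb) L Lθ J) pv τ'' (2 * i + 1) = 0 := by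
      intro i hi τ'' hτ''
      exact hzero (2 * i + 1) (by rw [← h2k]; omega) ⟨i, by ring⟩ τ'' hτ''
    have key := S.padic_kstep_pm J₀ J (S.toQ.flat.box (h := h) (Lb := Lb) L Lθ J) pv sgn hsgn' hcls' hρG (kpts := kpts)
      (Tlo := T / 2 ^ J - k * t) (t := t) ht hzero' hΛ
      (Dmax := Dmax k) (Mmax := Mmax k) (hsz k hk') (hfin k hk')
    refine key s (by rw [h4k]; exact hs) hodd τ ?_
    have h2 : (k + 1) * t ≤ T / 2 ^ J :=
      le_trans (Nat.mul_le_mul_right _ (by omega)) htT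
    rw [Nat.succ_mul] at hτ
    omega

/-! ### The inputs of the outer induction and the composition -/

/-- **The half step with the class update at level `J`**: from the classed invariant at level `J`
with integer bound `P` and the vanishing delivered by the inner chain (odd `s < 2^{d+J} S₀`,
`|τ| < T/2ᴶ − d t`), the classed invariant at level `J + 1` with the same bound.
[cite: Yu1990, §2.4 Lemmas 2.4–2.5] [cite: Waldschmidt1980, Lemma 3.7 (pp. 272–273)] -/
def HalfStepPM (J₀ J : ℕ) (L : Fin S.d → ℕ) (Lθ S₀ T t : ℕ) (P : ℤ) : Prop :=
  ∀ pv : Idx S.d h Lb → ℤ, S.InvPM J₀ L Lθ S₀ T P J pv →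
    (∀ s, s < 2 ^ (S.d + J) * S₀ → Odd s → ∀ τ : Tau S.d, tauNorm τ < T / 2 ^ J - S.d * t →
      S.toQ.coreSum J₀ J (S.toQ.flat.box (h := h) (Lb := Lb) L Lθ J) pv τ s = 0) →
    ∃ pv' : Idx S.d h Lb → ℤ, S.InvPM J₀ L Lθ S₀ T P (J + 1) pv'

/-- **Level `0`: Siegel's lemma on one class** (`SetupQ.siegel_step` restricted to the unknowns of
one class value; a class with at least `#box₀/G` unknowns exists by pigeonhole over `μ_G`).
[cite: Yu1990, §2.3 Lemma 2.1] [cite: Waldschmidt1980, Lemma 3.2 (pp. 266–267)] -/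
def SiegelPM (J₀ : ℕ) (L : Fin S.d → ℕ) (Lθ S₀ T : ℕ) (P : ℤ) : Prop :=
  ∃ pv : Idx S.d h Lb → ℤ, S.InvPM J₀ L Lθ S₀ T P 0 pv

/-- **The contradiction at the top level `J₀`** (the class is forgotten: `SetupQ.w80_endgame`).
[cite: Yu1990, §2.5] [cite: Waldschmidt1980, §3.5 (p. 274)] -/
def EndgamePM (J₀ : ℕ) (L : Fin S.d → ℕ) (Lθ S₀ T : ℕ) (P : ℤ) : Prop :=
  ∀ pv : Idx S.d h Lb → ℤ, S.InvPM J₀ L Lθ S₀ T P J₀ pv → False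

/-- **The classed invariant passes from `J` to `J + 1`**: inner chain, then the half step.
[cite: Yu1990, §2.4] [cite: Waldschmidt1980, Lemmas 3.6–3.7 (pp. 272–273)] -/
theorem invPM_succ {J₀ J : ℕ} {L : Fin S.d → ℕ} {Lθ S₀ T : ℕ} {P : ℤ} {t : ℕ → ℕ}
    (hS₀ : Even S₀) (ht : 1 ≤ t J) (htT : (S.d + 1) * t J ≤ T / 2 ^ J)
    (hΛ : ‖S.Λ₀‖ ≤ (p : ℝ)⁻¹) {Dmax Mmax : ℕ → ℕ → ℝ}
    (hsz : ∀ pv : Idx S.d h Lb → ℤ, S.InvPM J₀ L Lθ S₀ T P J pv →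
      S.KSizes J₀ J L Lθ S₀ T (t J) pv (Dmax J) (Mmax J))
    (hfin : S.KFinal (h := h) (Lb := Lb) J S₀ (t J) (Dmax J) (Mmax J))
    (hhalf : S.HalfStepPM (h := h) (Lb := Lb) J₀ J L Lθ S₀ T (t J) P)
    {pv : Idx S.d h Lb → ℤ} (inv : S.InvPM J₀ L Lθ S₀ T P J pv) :
    ∃ pv' : Idx S.d h Lb → ℤ, S.InvPM J₀ L Lθ S₀ T P (J + 1) pv' :=
  hhalf pv inv (S.kchain_pm inv hS₀ ht htT hΛ (hsz pv inv) hfin S.d le_rfl)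

/-- **The classed invariant at every level `J ≤ J₀`.** [cite: Yu1990, §2.4] [cite: Waldschmidt1980, §3.4–3.5] -/
theorem invPM_all {J₀ : ℕ} {L : Fin S.d → ℕ} {Lθ S₀ T : ℕ} {P : ℤ} {t : ℕ → ℕ}
    (hS₀ : Even S₀) (ht : ∀ J, J < J₀ → 1 ≤ t J)
    (htT : ∀ J, J < J₀ → (S.d + 1) * t J ≤ T / 2 ^ J)
    (hΛ : ‖S.Λ₀‖ ≤ (p : ℝ)⁻¹) {Dmax Mmax : ℕ → ℕ → ℝ}
    (hsz : ∀ J, J < J₀ → ∀ pv : Idx S.d h Lb → ℤ, S.InvPM J₀ L Lθ S₀ T P J pv →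
      S.KSizes J₀ J L Lθ S₀ T (t J) pv (Dmax J) (Mmax J))
    (hfin : ∀ J, J < J₀ → S.KFinal (h := h) (Lb := Lb) J S₀ (t J) (Dmax J) (Mmax J))
    (hhalf : ∀ J, J < J₀ → S.HalfStepPM (h := h) (Lb := Lb) J₀ J L Lθ S₀ T (t J) P)
    (hsiegel : S.SiegelPM (h := h) (Lb := Lb) J₀ L Lθ S₀ T P) :
    ∀ J, J ≤ J₀ → ∃ pv : Idx S.d h Lb → ℤ, S.InvPM J₀ L Lθ S₀ T P J pv := by
  intro J
  induction J with
  | zero => intro _; exact hsiegel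
  | succ J ih =>
    intro hJ
    obtain ⟨pv, inv⟩ := ih (by omega)
    have hJ' : J < J₀ := by omega
    exact S.invPM_succ hS₀ (ht J hJ') (htT J hJ') hΛ (hsz J hJ') (hfin J hJ') (hhalf J hJ') inv

/-- **The twisted `p`-adic machine**: if Siegel's lemma starts the descent on a class, the sizes and
the numerical inequalities of every inner step hold, the half steps pass the classed invariant up,
and the top level is contradictory, then the smallness hypothesis `‖Λ₀‖_p ≤ p⁻¹` is absurd.
[cite: Yu1990, Proposition 2.1] [cite: Waldschmidt1980, Prop. 3.8 and §3.5 (pp. 263, 274)] -/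
theorem main_pm {J₀ : ℕ} {L : Fin S.d → ℕ} {Lθ S₀ T : ℕ} {P : ℤ} {t : ℕ → ℕ}
    (hS₀ : Even S₀) (ht : ∀ J, J < J₀ → 1 ≤ t J)
    (htT : ∀ J, J < J₀ → (S.d + 1) * t J ≤ T / 2 ^ J)
    (hΛ : ‖S.Λ₀‖ ≤ (p : ℝ)⁻¹) {Dmax Mmax : ℕ → ℕ → ℝ}
    (hsz : ∀ J, J < J₀ → ∀ pv : Idx S.d h Lb → ℤ, S.InvPM J₀ L Lθ S₀ T P J pv →
      S.KSizes J₀ J L Lθ S₀ T (t J) pv (Dmax J) (Mmax J))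
    (hfin : ∀ J, J < J₀ → S.KFinal (h := h) (Lb := Lb) J S₀ (t J) (Dmax J) (Mmax J))
    (hhalf : ∀ J, J < J₀ → S.HalfStepPM (h := h) (Lb := Lb) J₀ J L Lθ S₀ T (t J) P)
    (hsiegel : S.SiegelPM (h := h) (Lb := Lb) J₀ L Lθ S₀ T P)
    (hend : S.EndgamePM (h := h) (Lb := Lb) J₀ L Lθ S₀ T P) : False := by
  obtain ⟨pv, inv⟩ := S.invPM_all hS₀ ht htT hΛ hsz hfin hhalf hsiegel J₀ le_rfl
  exact hend pv inv

/-- **The endgame forgets the class**: p3's sign-free `SetupQ.w80_endgame` (Waldschmidt's asymmetric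
endgame at the top level `J₀`: `L_θ < 2^{J₀}`, a multiplicity budget `T'` with
`T' + ∑ Lⱼ/2^{J₀} ≤ T/2^{J₀}` and the count `h·L_b < T' · #{odd s < 2^{J₀} S₀}`) discharges `Endgame`.
[cite: Waldschmidt1980, §3.5 (p. 274)] -/
theorem endgamePM_of_numbers {J₀ : ℕ} {L : Fin S.d → ℕ} {Lθ S₀ T : ℕ} {P : ℤ} {T' : ℕ}
    (hcount : h * Lb < T' * ((range (2 ^ J₀ * S₀)).filter Odd).card) (hLθ : Lθ < 2 ^ J₀)
    (hT' : T' + ∑ j, L j / 2 ^ J₀ ≤ T / 2 ^ J₀) :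
    S.EndgamePM (h := h) (Lb := Lb) J₀ L Lθ S₀ T P :=
  fun _ inv => S.toQ.w80_endgame inv.inv hLθ hT' hcount

end TwistSetup




end Summit.ABC.StewartYu

end
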